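import Mathlib
import Summits.PneNP.PneNP.Theorems.CnfIdealGenLengthRankDefectRepresentationsMergeLowerBound
import Summits.PneNP.PneNP.Theorems.CnfIdealGenLengthRankDefectRepresentationsGradedStability

/-!
# Crux `RankDefectRepresentations` (stmt-PneNP-18923), line `rank-dehn-ladder`: GRADED STABILITY in matrix form (lead g8)

`Theorems/…GradedStability` proves, in connection language, that a `GL_m`-connection `x` on the cube graph is within total rank
`¼ · totalDefect x` of a flat one (`graded_stability_flat`).  This file assembles the connection into the actual involution MATRICES
`X_i := blockPerm i (x · i)` on `V = ⊕_{u ⊆ [n]} K^m` (`X_i` maps the summand `u` to `u △ {i}` by `x u i`) and restates the theorem in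
the vocabulary of `stub_uniformStability`:

* `blockPerm_mul`, `gradedRep_comm`, `gradedRep_invol`: for a flat involutive connection (a pure gauge) the matrices `X′_i` are
  COMMUTING INVOLUTIONS — a genuine representation of `Z_2^n`;
* `rank_blockPerm_le`: `rank (X_i − X′_i) ≤ Σ_u rank (x u i − x′ u i)`;
* `graded_stability_matrix`: for every involutive connection `x` (`x (u△{i}) i · x u i = 1`) with `n ≥ 2` there is a genuine graded
  representation `X′` with **`2 · Σ_i rank (X_i − X′_i) ≤ totalDefect x`** `= Σ_u Σ_{i<j} rank (x_{u△i,j} x_{u,i} − x_{u△j,i} x_{u,j})`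
  (each square defect counted at its four corners; `rank [X_i,X_j] ≤ Σ_u sqDefect x u i j` by `rank_blockPerm_le`, with equality since the
  blocks sit in a permutation pattern — the equality is not needed and not formalised).  Hence `max_i rank(X_i − X′_i) ≤ n(n−1)t/4`-type
  bounds: graded almost-representations are quadratically rank-stable.
HONEST FRAMING: elementary; P ≠ NP is not moved; F-N2 is a FRONTIER formal rung; the ungraded `stub_uniformStability` stays open.
-/

set_option linter.dupNamespace false -- `Summit.PneNP.PneNP.…`: summit = sub-problem name (D-0017)

namespace Summit.PneNP.PneNP.Theorems.CnfIdealGenLengthRankDefectRepresentationsGradedStabilityMatrix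

open Finset Matrix Module
open scoped symmDiff
open Summit.PneNP.PneNP.Theorems.CnfIdealGenLengthRankDefectRepresentationsMergeLowerBound (rank_add_le' rank_sum_le' rank_neg')
open Summit.PneNP.PneNP.Theorems.CnfIdealGenLengthRankDefectRepresentationsGradedStability
  (Vert sqDefect totalDefect pureGauge pureGauge_flat pureGauge_back graded_stability_flat)

variable {K : Type} [Field K] {n m : ℕ}

/-- The involution matrix of direction `i` built from blocks `B u : V_u → V_{u △ {i}}`:
`(blockPerm i B)_{(w,a),(u,c)} = [w = u △ {i}] · (B u)_{a c}`. -/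
def blockPerm (i : Fin n) (B : Vert n → Matrix (Fin m) (Fin m) K) :
    Matrix (Vert n × Fin m) (Vert n × Fin m) K :=
  Matrix.of fun p q => if p.1 = q.1 ∆ {i} then B q.1 p.2 q.2 else 0

/-- `blockPerm` is additive in the blocks. -/
theorem blockPerm_sub (i : Fin n) (B C : Vert n → Matrix (Fin m) (Fin m) K) :
    blockPerm i B - blockPerm i C = blockPerm i (fun u => B u - C u) := by
  ext p q
  simp only [blockPerm, Matrix.sub_apply, Matrix.of_apply]
  split_ifs <;> simp

/-- Product of two block-permutation matrices: a block matrix on the pattern `w = u △ {j} △ {i}` with blocks `B (u△{j}) · C u`. -/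
theorem blockPerm_mul (i j : Fin n) (B C : Vert n → Matrix (Fin m) (Fin m) K) :
    blockPerm i B * blockPerm j C =
      Matrix.of fun p q : Vert n × Fin m =>
        if p.1 = q.1 ∆ {j} ∆ {i} then (B (q.1 ∆ {j}) * C q.1) p.2 q.2 else 0 := by
  classical
  ext p q
  rw [Matrix.mul_apply, Matrix.of_apply, ← Finset.univ_product_univ, Finset.sum_product]
  simp only [blockPerm, Matrix.of_apply]
  -- the sum over the intermediate block index collapses to `r.1 = q.1 △ {j}`
  rw [Finset.sum_eq_single (q.1 ∆ {j})]
  · by_cases h : p.1 = q.1 ∆ {j} ∆ {i}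
    · simp [h, Matrix.mul_apply]
    · simp [h]
  · intro w _ hw
    simp [hw]
  · simp

/-- The block-permutation matrices of a FLAT connection commute. -/
theorem gradedRep_comm (x' : Vert n → Fin n → Matrix (Fin m) (Fin m) K)
    (hflat : ∀ u i j, x' (u ∆ {i}) j * x' u i = x' (u ∆ {j}) i * x' u j) (i j : Fin n) :
    blockPerm i (fun u => x' u i) * blockPerm j (fun u => x' u j) =
      blockPerm j (fun u => x' u j) * blockPerm i (fun u => x' u i) := by
  rw [blockPerm_mul, blockPerm_mul]
  ext p q
  simp only [Matrix.of_apply]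
  rw [symmDiff_right_comm (q.1) {i} {j}, hflat q.1 j i]

/-- The block-permutation matrix of an INVOLUTIVE connection is an involution. -/
theorem gradedRep_invol (x' : Vert n → Fin n → Matrix (Fin m) (Fin m) K)
    (hback : ∀ u i, x' (u ∆ {i}) i * x' u i = 1) (i : Fin n) :
    blockPerm i (fun u => x' u i) * blockPerm i (fun u => x' u i) = 1 := by
  rw [blockPerm_mul]
  ext p q
  simp only [Matrix.of_apply, hback, symmDiff_assoc, symmDiff_self, symmDiff_bot, Matrix.one_apply,
    Prod.ext_iff]
  by_cases h1 : p.1 = q.1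
  · by_cases h2 : p.2 = q.2 <;> simp [h1, h2]
  · simp [h1]

/-- Rank of a block-permutation matrix is at most the sum of the block ranks. -/
theorem rank_blockPerm_le (i : Fin n) (B : Vert n → Matrix (Fin m) (Fin m) K) :
    (blockPerm i B).rank ≤ ∑ u : Vert n, (B u).rank := by
  classical
  -- column embedding into block `w` and row projection from block `u`
  set incl : Vert n → Matrix (Vert n × Fin m) (Fin m) K :=
    fun w => Matrix.of fun p a => if p.1 = w then (1 : Matrix (Fin m) (Fin m) K) p.2 a else 0 with hincl
  set proj : Vert n → Matrix (Fin m) (Vert n × Fin m) K :=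
    fun u => Matrix.of fun a q => if q.1 = u then (1 : Matrix (Fin m) (Fin m) K) a q.2 else 0 with hproj
  have hdec : blockPerm i B = ∑ u : Vert n, incl (u ∆ {i}) * B u * proj u := by
    ext p q
    rw [Matrix.sum_apply]
    have hterm : ∀ u : Vert n, (incl (u ∆ {i}) * B u * proj u) p q =
        if q.1 = u ∧ p.1 = u ∆ {i} then B u p.2 q.2 else 0 := by
      intro u
      simp only [hincl, hproj, Matrix.mul_apply, Matrix.of_apply, Matrix.one_apply, mul_ite, ite_mul, mul_one,
        mul_zero, zero_mul, one_mul]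
      by_cases hq : q.1 = u
      · by_cases hp : p.1 = u ∆ {i}
        · simp only [hq, hp, and_self, if_true]
          rw [Finset.sum_eq_single q.2]
          · rw [if_pos rfl, Finset.sum_eq_single p.2]
            · rw [if_pos rfl]
            · intro a _ ha; rw [if_neg (Ne.symm ha)]
            · simp
          · intro c _ hc; rw [if_neg hc]
          · simp
        · simp [hp]
      · simp [hq]
    simp only [hterm, blockPerm, Matrix.of_apply]
    rw [Finset.sum_eq_single q.1]
    · by_cases h : p.1 = q.1 ∆ {i} <;> simp [h]
    · intro w _ hw; simp [Ne.symm hw]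
    · simp
  rw [hdec]
  refine (rank_sum_le' _ _).trans (Finset.sum_le_sum fun u _ => ?_)
  exact (Matrix.rank_mul_le_left _ _).trans (Matrix.rank_mul_le_right _ _)

/-- For invertible square matrices, `rank (A⁻¹-type difference)`: if `A' A = 1` and `B' B = 1` then `rank (A' − B') = rank (A − B)`. -/
theorem rank_inv_sub_inv {A A' B B' : Matrix (Fin m) (Fin m) K} (hA : A' * A = 1) (hB : B' * B = 1) :
    (A' - B').rank = (A - B).rank := by
  have hA2 : A * A' = 1 := mul_eq_one_comm.mp hA
  have hB2 : B * B' = 1 := mul_eq_one_comm.mp hB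
  have e : A' - B' = A' * (B - A) * B' := by
    rw [Matrix.mul_sub, Matrix.sub_mul, Matrix.mul_assoc, hB2, Matrix.mul_one, hA, Matrix.one_mul]
  have hdA' : IsUnit A'.det := Matrix.isUnit_det_of_left_inverse hA2
  have hdB' : IsUnit B'.det := Matrix.isUnit_det_of_left_inverse hB2
  rw [e, Matrix.rank_mul_eq_left_of_isUnit_det _ _ hdB', Matrix.rank_mul_eq_right_of_isUnit_det _ _ hdA',
    ← neg_sub, rank_neg']


/-- Summing a function over all vertices = twice the sum over the `b`-oriented edges of direction `i`, when the function takes the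
same value at both endpoints' blocks (`f (u △ {i}) = f u`). -/
theorem sum_eq_two_mul_sum_oriented (f : Vert n → ℕ) (i : Fin n) (b : Vert n) (hf : ∀ u, f (u ∆ {i}) = f u) :
    ∑ u : Vert n, f u = 2 * ∑ v ∈ (Finset.univ : Finset (Vert n)).filter (fun v => i ∉ v), f (v ∆ b) := by
  classical
  -- reindex by the translation `v ↦ v △ b`
  have h1 : ∑ u : Vert n, f u = ∑ v : Vert n, f (v ∆ b) := by
    refine (Finset.sum_bij (fun v _ => v ∆ b) (by simp) ?_ ?_ (by intro v _; rfl)).symm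
    · intro v₁ _ v₂ _ h; simpa [symmDiff_left_inj] using h
    · intro u _; exact ⟨u ∆ b, by simp, by simp⟩
  rw [h1, ← Finset.sum_filter_add_sum_filter_not Finset.univ (fun v : Vert n => i ∉ v), two_mul]
  congr 1
  -- the `i ∈ v` half, reindexed by `v ↦ v.erase i`
  refine Finset.sum_bij (fun v _ => v.erase i) ?_ ?_ ?_ ?_
  · intro v hv; simp
  · intro v₁ hv₁ v₂ hv₂ h
    have h1' : i ∈ v₁ := by simpa using hv₁
    have h2' : i ∈ v₂ := by simpa using hv₂
    rw [← Finset.insert_erase h1', ← Finset.insert_erase h2', h]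
  · intro w hw
    have hw' : i ∉ w := by simpa using hw
    exact ⟨insert i w, by simp, Finset.erase_insert hw'⟩
  · intro v hv
    have hv' : i ∈ v := by simpa using hv
    have e : v ∆ b = ((v.erase i) ∆ b) ∆ {i} := by
      conv_lhs => rw [← Finset.insert_erase hv']
      rw [← Summit.PneNP.PneNP.Theorems.CnfIdealGenLengthRankDefectRepresentationsGradedStability.symmDiff_singleton_eq_insert
        (Finset.notMem_erase i v), symmDiff_right_comm]
    rw [e, hf]

/-- **GRADED STABILITY, matrix form.**  Let `x` be an involutive `GL_m`-connection on the `n`-cube graph (`n ≥ 2`), `X_i := blockPerm i (x · i)`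
the corresponding involutions on `⊕_u K^m`.  Then there is a FLAT involutive connection `x′` — whose matrices `X′_i` are commuting
involutions, a genuine graded representation of `Z_2^n` — with `2 · Σ_i rank (X_i − X′_i) ≤ totalDefect x`
(`= Σ_u Σ_{i<j} rank (x_{u△i,j} x_{u,i} − x_{u△j,i} x_{u,j})`, the commutator ranks `Σ_{i<j} rank [X_i,X_j]` counted blockwise). -/
theorem graded_stability_matrix (hn : 2 ≤ n) (x : Vert n → Fin n → Matrix (Fin m) (Fin m) K)
    (hinv : ∀ u i, x (u ∆ {i}) i * x u i = 1) :
    ∃ x' : Vert n → Fin n → Matrix (Fin m) (Fin m) K,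
      (∀ i j, blockPerm i (fun u => x' u i) * blockPerm j (fun u => x' u j) =
               blockPerm j (fun u => x' u j) * blockPerm i (fun u => x' u i)) ∧
      (∀ i, blockPerm i (fun u => x' u i) * blockPerm i (fun u => x' u i) = 1) ∧
      2 * ∑ i : Fin n, (blockPerm i (fun u => x u i) - blockPerm i (fun u => x' u i)).rank ≤ totalDefect x := by
  classical
  have hx : ∀ u i, IsUnit (x u i) := fun u i =>
    (Matrix.isUnit_iff_isUnit_det _).mpr (Matrix.isUnit_det_of_left_inverse (hinv u i))
  obtain ⟨b, G, hG, hbound⟩ := graded_stability_flat x hn hx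
  refine ⟨pureGauge G, fun i j => gradedRep_comm _ (pureGauge_flat hG) i j,
    fun i => gradedRep_invol _ (pureGauge_back hG) i, ?_⟩
  have hback := pureGauge_back hG
  -- per direction: rank (X_i − X′_i) ≤ Σ_u rank (x u i − x′ u i) = 2 · (oriented sum)
  have hdir : ∀ i : Fin n, (blockPerm i (fun u => x u i) - blockPerm i (fun u => pureGauge G u i)).rank ≤
      2 * ∑ v ∈ (Finset.univ : Finset (Vert n)).filter (fun v => i ∉ v),
        (pureGauge G (v ∆ b) i - x (v ∆ b) i).rank := by
    intro i
    rw [blockPerm_sub]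
    refine (rank_blockPerm_le i _).trans (le_of_eq ?_)
    have hsym : ∀ u, (x u i - pureGauge G u i).rank = (pureGauge G u i - x u i).rank := fun u => by
      rw [← neg_sub, rank_neg']
    simp only [hsym]
    refine sum_eq_two_mul_sum_oriented (fun u => (pureGauge G u i - x u i).rank) i b fun u => ?_
    exact rank_inv_sub_inv (hback u i) (hinv u i)
  calc 2 * ∑ i : Fin n, (blockPerm i (fun u => x u i) - blockPerm i (fun u => pureGauge G u i)).rank
      ≤ 2 * ∑ i : Fin n, (2 * ∑ v ∈ (Finset.univ : Finset (Vert n)).filter (fun v => i ∉ v),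
          (pureGauge G (v ∆ b) i - x (v ∆ b) i).rank) := Nat.mul_le_mul_left 2 (Finset.sum_le_sum fun i _ => hdir i)
    _ = 4 * ∑ v : Vert n, ∑ i ∈ (Finset.univ : Finset (Fin n)).filter (fun i => i ∉ v),
          (pureGauge G (v ∆ b) i - x (v ∆ b) i).rank := by
        rw [← Finset.mul_sum, ← mul_assoc]
        congr 1
        rw [Finset.sum_comm' (t' := Finset.univ) (s' := fun v => (Finset.univ : Finset (Fin n)).filter (fun i => i ∉ v))]
        intro i v; simp
    _ ≤ totalDefect x := hbound

end Summit.PneNP.PneNP.Theorems.CnfIdealGenLengthRankDefectRepresentationsGradedStabilityMatrix
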